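import Mathlib
import Summits.ValiantsHypothesis.ValiantsHypothesis.Theorems.ProofCarryingSymmetryRestorationQPESatPeel

/-!
# Route ProofCarryingSymmetry — crux `RestorationQP`, line `registered`: e-saturated normal forms, part 3 —
the peeled smart product

Support file for the crux item `stmt-ValiantsHypothesis-10343` (lead c5, cycle 5), continuing
`…ESatPeel`.  For a generic ground distributivity instance `d`:

* root saturation of small formulas and of non-products (`kmax_mset_eq_zero_of_nvars_lt`,
  `kmax_mset_eq_zero_of_length_le`);
* the structure of peeling: root factors, root factor classes, root constant and normality of
  `epeel d x` (`margs_epeel`, `mset_epeel`, `mcst_epeel`, `nf_epeel`), root saturation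
  (`kmax_mset_epeel`) and AC-congruence (`epeel_congr`);
* the structure of the peeled smart product `emul d a b` of normal forms (`mset_emul`, `nf_emul`,
  `kmax_mset_emul`) and its laws modulo AC: congruence, commutativity, ASSOCIATIVITY (peeling
  `kmax K` copies first and saturating after adding `L` is saturating `K + L` at once:
  `peel_twice`), `a · 0 ↦ 0`, `a · 1 ↦ a` on root-saturated normal forms, constants.

With the smart sum `sadd` (lead c2) these are all the identities of the distributivity-free
fragment; part 4 (`…ESatHom`) adds the ground instance itself and concludes that the e-saturation
`esat d` respects `UCEqWith d.eqn`.  Everything is elementary and proved; no named facts.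
-/

-- single-problem summit: `Summit.ValiantsHypothesis.ValiantsHypothesis.…` is the namespace by design (D-0017)
set_option linter.dupNamespace false

noncomputable section

open scoped Classical

namespace Summit.ValiantsHypothesis.ValiantsHypothesis.Theorems

namespace ACStability

open Literature.Computability.AlgebraicComplexity ACClass

universe u v

variable {𝔽 : Type u} {X : Type v}

section Field

variable [Field 𝔽]

/-! ### Root saturation -/

/-- If the pattern fits into a multiset of classes, its leaf weight is bounded by theirs. [folklore] -/
theorem patVars_le_of_pat_le (d : DistData 𝔽 X) {K : Multiset (ACClass 𝔽 X)} (h : d.pat ≤ K) :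
    d.patVars ≤ (K.map ACClass.nvars).sum := by
  rw [← DistData.pat_nvars_sum]
  exact ACClass.nvars_sum_le_of_le h

/-- The leaf weight of the root factor classes is the leaf count. [folklore] -/
theorem mset_nvars_sum (x : PIFormula 𝔽 X) : ((mset x).map ACClass.nvars).sum = nvars x := by
  rw [mset_def, Multiset.map_coe, Multiset.sum_coe, List.map_map]
  have : (ACClass.nvars ∘ mk : PIFormula 𝔽 X → ℕ) = nvars := rfl
  rw [this]
  exact nvars_margs_sum x

/-- **Small formulas are root-saturated**: if `nvars x < patVars` no copy of the pattern peels.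
[folklore] -/
theorem kmax_mset_eq_zero_of_nvars_lt (d : DistData 𝔽 X) {x : PIFormula 𝔽 X} (h : nvars x < d.patVars) :
    kmax (mset x) d.pat = 0 := by
  rw [kmax_eq_zero_iff d.pat_ne_zero]
  intro hle
  have := patVars_le_of_pat_le d hle
  rw [mset_nvars_sum] at this
  omega

/-- **Non-products are root-saturated** (generic instance): a formula with at most one root factor
admits no copy of the pattern. [folklore] -/
theorem kmax_mset_eq_zero_of_length_le {d : DistData 𝔽 X} (hg : d.Generic) {x : PIFormula 𝔽 X}
    (h : (margs x).length ≤ 1) : kmax (mset x) d.pat = 0 := by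
  rw [kmax_eq_zero_iff d.pat_ne_zero]
  intro hle
  have h2 := (hg.two_le_card_pat).trans (Multiset.card_le_card hle)
  rw [mset_def, Multiset.coe_card, List.length_map] at h2
  omega

omit [Field 𝔽] in
/-- Nothing peels from the empty multiset. [folklore] -/
theorem kmax_zero_left {D : Multiset (ACClass 𝔽 X)} (hD : D ≠ 0) : kmax (0 : Multiset (ACClass 𝔽 X)) D = 0 :=
  (kmax_eq_zero_iff hD).2 fun hle => hD (Multiset.le_zero.1 hle)

omit [Field 𝔽] in
/-- `kmax_sub_nsmul` for class multisets (bridging the `DecidableEq` instance used for `-`). [folklore] -/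
theorem kmax_sub_nsmul' {K D : Multiset (ACClass 𝔽 X)} {j : ℕ} (hj : j • D ≤ K) :
    kmax (K - j • D) D = kmax K D - j := by
  convert kmax_sub_nsmul hj using 3
  congr 2
  all_goals exact Subsingleton.elim _ _

/-! ### The structure of peeling -/

section Peel

variable {d : DistData 𝔽 X} {x : PIFormula 𝔽 X}

/-- The new factor list after peeling `k` copies. [folklore] -/
theorem peel_list_spec (hg : d.Generic) (hx : NF x) (k : ℕ) :
    ∀ f ∈ removeBy (margs x) (k • d.pat) ++ List.replicate k d.sig,
      NF f ∧ constOf f = none ∧ headLabel f ≠ .mul := by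
  intro f hf
  rcases List.mem_append.1 hf with hf | hf
  · exact hx.margs_spec f (mem_of_mem_removeBy hf)
  · rw [List.eq_of_mem_replicate hf]
    exact ⟨d.nf_sig, hg.sig_shape⟩

/-- **Root factors after peeling.** [folklore] -/
theorem margs_epeel (hg : d.Generic) (hx : NF x) (hk : kmax (mset x) d.pat ≠ 0) :
    margs (epeel d x) = removeBy (margs x) (kmax (mset x) d.pat • d.pat) ++
      List.replicate (kmax (mset x) d.pat) d.sig := by
  rw [epeel_of_kmax_ne_zero d hk, margs_def,
    msplit_mmk (olist_spec (peel_list_spec hg hx _))]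
  exact omulArgs_olist fun f hf => (peel_list_spec hg hx _ f hf).2.2

/-- **Root constant after peeling.** [folklore] -/
theorem mcst_epeel (hg : d.Generic) (hx : NF x) (hk : kmax (mset x) d.pat ≠ 0) :
    mcst (epeel d x) = mcst x * d.cP⁻¹ ^ kmax (mset x) d.pat := by
  rw [epeel_of_kmax_ne_zero d hk, mcst_def, msplit_mmk (olist_spec (peel_list_spec hg hx _))]

/-- **Root factor classes after peeling**: `k` copies of the pattern out, `k` copies of the class of
the expansion in. [folklore] -/
theorem mset_epeel (hg : d.Generic) (hx : NF x) :
    mset (epeel d x) = mset x - kmax (mset x) d.pat • d.pat +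
      Multiset.replicate (kmax (mset x) d.pat) (mk d.sig) := by
  by_cases hk : kmax (mset x) d.pat = 0
  · rw [epeel_of_kmax_eq_zero d hk, hk]; simp
  · rw [mset_def, margs_epeel hg hx hk, List.map_append, ← Multiset.coe_add, List.map_replicate,
      Multiset.coe_replicate]
    congr 1
    rw [mset_def]
    exact coe_map_mk_removeBy _ (by simpa only [mset_def] using nsmul_kmax_le (mset x) d.pat)

/-- **Peeling preserves normal forms.** [folklore] -/
theorem nf_epeel (hg : d.Generic) (hx : NF x) : NF (epeel d x) := by
  by_cases hk : kmax (mset x) d.pat = 0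
  · rw [epeel_of_kmax_eq_zero d hk]; exact hx
  · rw [epeel_of_kmax_ne_zero d hk]
    refine nf_mmk (olist_spec (peel_list_spec hg hx _)) (mul_ne_zero ?_ ?_)
    · intro h0
      apply hk
      rw [mcst_def] at h0
      rw [hx.eq_const_zero_of_msplit h0, mset_const]
      exact kmax_zero_left d.pat_ne_zero
    · exact pow_ne_zero _ (inv_ne_zero hg.cP_ne_zero)

/-- **Peeling saturates the root**: no copy of the pattern is left. [folklore] -/
theorem kmax_mset_epeel (hg : d.Generic) (hx : NF x) : kmax (mset (epeel d x)) d.pat = 0 := by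
  rw [mset_epeel hg hx, kmax_add_of_forall_not_mem _ fun c hc => ?_, kmax_sub_nsmul' (nsmul_kmax_le _ _),
    Nat.sub_self]
  rw [Multiset.eq_of_mem_replicate hc]
  exact hg.mk_sig_not_mem_pat

/-- **Peeling respects AC-equivalence of normal forms.** [folklore] -/
theorem epeel_congr (hg : d.Generic) {x' : PIFormula 𝔽 X} (hx : NF x) (hx' : NF x') (e : ACEq x x') :
    ACEq (epeel d x) (epeel d x') := by
  obtain ⟨h1, h2⟩ := hx.mset_eq_of_acEq hx' e
  refine (nf_epeel hg hx).acEq_of_mset_eq (nf_epeel hg hx') ?_ ?_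
  · rw [mset_epeel hg hx, mset_epeel hg hx', h1]
  · by_cases hk : kmax (mset x) d.pat = 0
    · have hk' : kmax (mset x') d.pat = 0 := h1 ▸ hk
      rw [epeel_of_kmax_eq_zero d hk, epeel_of_kmax_eq_zero d hk', h2]
    · have hk' : kmax (mset x') d.pat ≠ 0 := h1 ▸ hk
      rw [mcst_epeel hg hx hk, mcst_epeel hg hx' hk', h1, h2]

/-- A root-saturated formula is fixed by peeling. [folklore] -/
theorem epeel_of_saturated {x : PIFormula 𝔽 X} (h : kmax (mset x) d.pat = 0) : epeel d x = x :=
  epeel_of_kmax_eq_zero d h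

end Peel

/-! ### The peeled smart product -/

section EMul

variable {d : DistData 𝔽 X}

/-- Root factor classes and root constant of a smart product of normal forms. [folklore] -/
theorem mset_smul {a b : PIFormula 𝔽 X} (ha : NF a) (hb : NF b) (h : mcst a * mcst b ≠ 0) :
    mset (smul a b) = mset a + mset b ∧ mcst (smul a b) = mcst a * mcst b := by
  rw [mcst_def, mcst_def] at h
  refine ⟨?_, by rw [mcst_def, msplit_smul_snd ha hb]; rfl⟩
  rw [mset_def, mset_def, mset_def, margs_def, margs_def, margs_def, msplit_smul_fst ha hb h,
    Multiset.coe_add, ← List.map_append]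
  congr 2
  cases (msplit a).1 <;> cases (msplit b).1 <;> simp [mmerge, omulArgs, mulArgs]

/-- A smart product of normal forms whose constants multiply to zero is `0`. [folklore] -/
theorem smul_eq_zero_of_mcst {a b : PIFormula 𝔽 X} (h : mcst a * mcst b = 0) : smul a b = .const 0 :=
  smul_of_eq_zero h

/-- **The peeled product is `0` when the constants multiply to `0`.** [folklore] -/
theorem emul_of_mcst_eq_zero {a b : PIFormula 𝔽 X} (h : mcst a * mcst b = 0) : emul d a b = .const 0 := by
  rw [emul, smul_eq_zero_of_mcst h, epeel_of_saturated]
  rw [mset_const]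
  exact kmax_zero_left d.pat_ne_zero

/-- **Structure of the peeled product** of normal forms with non-vanishing constants: with
`k = kmax (mset a + mset b) pat`, the root factor classes are `mset a + mset b - k • pat + k • {sig}`
and the root constant is `mcst a · mcst b · cP⁻¹ ^ k`. [folklore] -/
theorem mset_emul (hg : d.Generic) {a b : PIFormula 𝔽 X} (ha : NF a) (hb : NF b) (h : mcst a * mcst b ≠ 0) :
    mset (emul d a b) = mset a + mset b - kmax (mset a + mset b) d.pat • d.pat +
        Multiset.replicate (kmax (mset a + mset b) d.pat) (mk d.sig) ∧
      mcst (emul d a b) = mcst a * mcst b * d.cP⁻¹ ^ kmax (mset a + mset b) d.pat := by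
  obtain ⟨h1, h2⟩ := mset_smul ha hb h
  refine ⟨by rw [emul, mset_epeel hg (nf_smul ha hb), h1], ?_⟩
  by_cases hk : kmax (mset (smul a b)) d.pat = 0
  · rw [emul, epeel_of_kmax_eq_zero d hk, h2, ← h1, hk, pow_zero, mul_one]
  · rw [emul, mcst_epeel hg (nf_smul ha hb) hk, h1, h2]

/-- **The peeled product of normal forms is a normal form.** [folklore] -/
theorem nf_emul (hg : d.Generic) {a b : PIFormula 𝔽 X} (ha : NF a) (hb : NF b) : NF (emul d a b) :=
  nf_epeel hg (nf_smul ha hb)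

/-- **The peeled product is root-saturated.** [folklore] -/
theorem kmax_mset_emul (hg : d.Generic) {a b : PIFormula 𝔽 X} (ha : NF a) (hb : NF b) :
    kmax (mset (emul d a b)) d.pat = 0 :=
  kmax_mset_epeel hg (nf_smul ha hb)

/-- The root constant of a normal form vanishes only for the constant `0`. [folklore] -/
theorem NF.mcst_eq_zero_iff {x : PIFormula 𝔽 X} (hx : NF x) : mcst x = 0 ↔ x = .const 0 :=
  ⟨fun h => hx.eq_const_zero_of_msplit h, fun h => by rw [h]; rfl⟩

/-- **Congruence**: the peeled product respects AC-equivalence of normal forms. [folklore] -/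
theorem emul_congr (hg : d.Generic) {a a' b b' : PIFormula 𝔽 X} (ha : NF a) (ha' : NF a') (hb : NF b)
    (hb' : NF b') (e₁ : ACEq a a') (e₂ : ACEq b b') : ACEq (emul d a b) (emul d a' b') :=
  epeel_congr hg (nf_smul ha hb) (nf_smul ha' hb') (smul_congr ha ha' hb hb' e₁ e₂)

/-- **Commutativity** of the peeled product up to AC. [folklore] -/
theorem acEq_emul_comm (hg : d.Generic) {a b : PIFormula 𝔽 X} (ha : NF a) (hb : NF b) :
    ACEq (emul d a b) (emul d b a) :=
  epeel_congr hg (nf_smul ha hb) (nf_smul hb ha) (acEq_smul_comm a b)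

/-- A8 for the peeled product: `a · 0 ↦ 0`. [folklore] -/
theorem emul_const_zero (a : PIFormula 𝔽 X) : emul d a (.const 0) = .const 0 :=
  emul_of_mcst_eq_zero (by simp)

/-- A9 for the peeled product: `a · 1 ↦ a` for a root-saturated normal form `a`. [folklore] -/
theorem emul_const_one {a : PIFormula 𝔽 X} (ha : NF a) (h : kmax (mset a) d.pat = 0) :
    emul d a (.const 1) = a := by
  rw [emul, smul_const_one ha, epeel_of_saturated h]

/-- A10 for the peeled product: constants multiply. [folklore] -/
theorem emul_const_const (b c : 𝔽) : emul d (.const b : PIFormula 𝔽 X) (.const c) = .const (b * c) := by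
  rw [emul, smul_const_const, epeel_of_saturated]
  rw [mset_const]
  exact kmax_zero_left d.pat_ne_zero

/-! ### Associativity -/

/-- The peeling count of a factor multiset enlarged by classes of the expansion and reduced by
`j ≤ kmax` copies of the pattern. [folklore] -/
theorem kmax_peeled (hg : d.Generic) (K : Multiset (ACClass 𝔽 X)) {j : ℕ} (hj : j • d.pat ≤ K) (i : ℕ) :
    kmax (K - j • d.pat + Multiset.replicate i (mk d.sig)) d.pat = kmax K d.pat - j := by
  rw [kmax_add_of_forall_not_mem _ fun c hc => ?_, kmax_sub_nsmul' hj]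
  rw [Multiset.eq_of_mem_replicate hc]
  exact hg.mk_sig_not_mem_pat

/-- **Multiset bookkeeping for associativity**: peeling `j = kmax K` copies from `K` first and
then saturating after adding `L` is saturating `K + L` at once. [folklore] -/
theorem peel_twice (hg : d.Generic) (K L : Multiset (ACClass 𝔽 X)) :
    kmax K d.pat + kmax (K - kmax K d.pat • d.pat + Multiset.replicate (kmax K d.pat) (mk d.sig) + L) d.pat =
        kmax (K + L) d.pat ∧
      K - kmax K d.pat • d.pat + Multiset.replicate (kmax K d.pat) (mk d.sig) + L -
          kmax (K - kmax K d.pat • d.pat + Multiset.replicate (kmax K d.pat) (mk d.sig) + L) d.pat • d.pat +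
          Multiset.replicate
            (kmax (K - kmax K d.pat • d.pat + Multiset.replicate (kmax K d.pat) (mk d.sig) + L) d.pat) (mk d.sig) =
        K + L - kmax (K + L) d.pat • d.pat + Multiset.replicate (kmax (K + L) d.pat) (mk d.sig) := by
  set j := kmax K d.pat with hj_def
  set κ := kmax (K + L) d.pat with hκ_def
  have hj : j • d.pat ≤ K := nsmul_kmax_le K d.pat
  have hjKL : j • d.pat ≤ K + L := hj.trans (Multiset.le_add_right _ _)
  have hjκ : j ≤ κ := kmax_mono (Multiset.le_add_right K L) d.pat
  -- regroup: first peel, then add `L` = add `L`, then peel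
  have hM : K - j • d.pat + Multiset.replicate j (mk d.sig) + L =
      K + L - j • d.pat + Multiset.replicate j (mk d.sig) := by
    rw [add_right_comm, tsub_add_eq_add_tsub hj]
  rw [hM, kmax_peeled hg (K + L) hjKL, ← hκ_def]
  refine ⟨by omega, ?_⟩
  have hκle : κ • d.pat ≤ K + L := nsmul_kmax_le (K + L) d.pat
  have hsplit : κ • d.pat = j • d.pat + (κ - j) • d.pat := by rw [← add_nsmul]; congr 1; omega
  have hk : (κ - j) • d.pat ≤ K + L - j • d.pat := by
    apply le_tsub_of_add_le_left
    rw [← hsplit]; exact hκle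
  rw [← tsub_add_eq_add_tsub hk, tsub_tsub, ← hsplit, add_assoc, ← Multiset.replicate_add]
  congr 2
  omega

/-- `peel_twice` with the extra factors added on the left. [folklore] -/
theorem peel_twice_left (hg : d.Generic) (K L : Multiset (ACClass 𝔽 X)) :
    kmax K d.pat + kmax (L + (K - kmax K d.pat • d.pat + Multiset.replicate (kmax K d.pat) (mk d.sig))) d.pat =
        kmax (L + K) d.pat ∧
      L + (K - kmax K d.pat • d.pat + Multiset.replicate (kmax K d.pat) (mk d.sig)) -
          kmax (L + (K - kmax K d.pat • d.pat + Multiset.replicate (kmax K d.pat) (mk d.sig))) d.pat • d.pat +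
          Multiset.replicate
            (kmax (L + (K - kmax K d.pat • d.pat + Multiset.replicate (kmax K d.pat) (mk d.sig))) d.pat) (mk d.sig) =
        L + K - kmax (L + K) d.pat • d.pat + Multiset.replicate (kmax (L + K) d.pat) (mk d.sig) := by
  have h := peel_twice hg K L
  rwa [add_comm (K - kmax K d.pat • d.pat + Multiset.replicate (kmax K d.pat) (mk d.sig)) L, add_comm K L] at h

/-- **Associativity** of the peeled product up to AC on normal forms. [folklore] -/
theorem acEq_emul_assoc (hg : d.Generic) {a b c : PIFormula 𝔽 X} (ha : NF a) (hb : NF b) (hc : NF c) :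
    ACEq (emul d a (emul d b c)) (emul d (emul d a b) c) := by
  have hz : ∀ {x y : PIFormula 𝔽 X}, mcst x = 0 ∨ mcst y = 0 → emul d x y = .const 0 :=
    fun h => emul_of_mcst_eq_zero (mul_eq_zero.2 h)
  -- the degenerate cases: a zero constant kills both sides
  by_cases ha0 : mcst a = 0
  · rw [hz (Or.inl ha0), hz (Or.inl ha0), hz (Or.inl (mcst_const 0))]; exact .refl _
  by_cases hb0 : mcst b = 0
  · rw [hz (Or.inl hb0), hz (Or.inr hb0), hz (Or.inr (mcst_const 0)), hz (Or.inl (mcst_const 0))]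
    exact .refl _
  by_cases hc0 : mcst c = 0
  · rw [hz (Or.inr hc0), hz (Or.inr hc0), hz (Or.inr (mcst_const 0))]; exact .refl _
  have hcP : d.cP⁻¹ ≠ 0 := inv_ne_zero hg.cP_ne_zero
  -- right-nested side
  obtain ⟨hX1, hX2⟩ := mset_emul hg hb hc (mul_ne_zero hb0 hc0)
  have hX0 : mcst a * mcst (emul d b c) ≠ 0 := by
    rw [hX2]; exact mul_ne_zero ha0 (mul_ne_zero (mul_ne_zero hb0 hc0) (pow_ne_zero _ hcP))
  obtain ⟨hY1, hY2⟩ := mset_emul hg ha (nf_emul hg hb hc) hX0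
  -- left-nested side
  obtain ⟨hX1', hX2'⟩ := mset_emul hg ha hb (mul_ne_zero ha0 hb0)
  have hX0' : mcst (emul d a b) * mcst c ≠ 0 := by
    rw [hX2']; exact mul_ne_zero (mul_ne_zero (mul_ne_zero ha0 hb0) (pow_ne_zero _ hcP)) hc0
  obtain ⟨hY1', hY2'⟩ := mset_emul hg (nf_emul hg ha hb) hc hX0'
  -- compare through the bookkeeping lemmas
  obtain ⟨hk, hm⟩ := peel_twice_left hg (mset b + mset c) (mset a)
  obtain ⟨hk', hm'⟩ := peel_twice hg (mset a + mset b) (mset c)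
  refine (nf_emul hg ha (nf_emul hg hb hc)).acEq_of_mset_eq (nf_emul hg (nf_emul hg ha hb) hc) ?_ ?_
  · rw [hY1, hX1, hY1', hX1', hm, hm', add_assoc]
  · rw [hY2, hX2, hY2', hX2', hX1, hX1']
    have e : ∀ (x y z P : 𝔽) (m n : ℕ), x * (y * z * P ^ m) * P ^ n = x * y * z * P ^ (m + n) := by
      intros; ring
    have e' : ∀ (x y z P : 𝔽) (m n : ℕ), x * y * P ^ m * z * P ^ n = x * y * z * P ^ (m + n) := by
      intros; ring
    rw [e, e', hk, hk', add_assoc]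

end EMul

end Field

end ACStability

end Summit.ValiantsHypothesis.ValiantsHypothesis.Theorems

end
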